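import Literature.AlgebraicGeometry.HodgeTheory.SemiregularVariationalHodgeISemiregularModel
import Literature.AlgebraicGeometry.KTheory.EulerCharacteristic
import Summits.Ventures.HSemireg.HigherSigmaOfIso
import HarnessLib

/-!
# Venture HSemireg — the PERFECT-COMPLEX door of the amplification chain («semiregular perfect complex at
# one fibre ⟹ its Chern character stays algebraic nearby»): real vocabulary, the object class, and the
# transfer statement as an honest SCHEMA in the admissibility notion

HONEST FRAMING. Part of the Lean index of the computation cell `pub-hsemireg` (seat p4, «Lean typer for the
amplification chain: Bloch 1972 / Buchweitz–Flenner 2003 semiregularity ⇒ variational Hodge conjecture»).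
Nothing here is a claim about any explicit variety and nothing here says that HC / HC_CM / HC_AV holds; every
published statement enters BY NAME; no Literature fact is declared in this file. What this file adds is exactly
delimited in «Kernel content» below.

## Survey first: what is ALREADY typed (and is therefore not re-typed here)

The transfer «semiregular representative at one fibre ⟹ class algebraic along the family» is in the tree at
printed scope for the two kinds of objects the refereed sources print it for: lci SUBSCHEMES (Bloch 1972
(7.1)/(7.4)/(7.5) = Buchweitz–Flenner 2003 Thm. 5.2 at `I = {p}`: facts `BlochSemiregularSpreadOfSubscheme`,
`BlochSemiregularSpread`, `Bloch1972_semiregularSubschemeLifts`, their PROVED global forms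
`….forall_mem_algebraicClasses*`, venture theorems `Bloch1972.theorem74{,_lci}`, `Bloch1972.semiregular_deforms{,_lci}`)
and finite locally free SHEAVES (Buchweitz–Flenner 2003 Thm. 5.1: facts
`BuchweitzFlenner2003_variationalHodge_ISemiregular{,_model}`, `…_semiregular`, venture theorems
`BuchweitzFlenner2003.semiregular_deforms{,_model}`; the preprint forms `Perry2026_semiregular*` are claim-grade facts
for finite locally free `E₀` only). Index of record: `run/shared/lean/pub/pub-hsemireg/lit/LEAN-MAP-Bloch1972-BF2003.md`
rows B1–B11/F1–F8, `theory/TH1-BLOCH-BF-LEAN.md` rows 1–10, 4′/5′/8′. The ONE transfer the cell's fourfold chain uses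
and the tree lacks is the door for a PERFECT COMPLEX (route (C): `𝓔 = Φ(I_{p×X ∪ X×q}) ⊗ M_B`, a two-term complex of
amplitude `[-1, 0]` and rank `-2` on the CM Weil-type fourfold `A₀ = X × X̂`). This file is that door, as far as it
can honestly be typed today.

## Sources, verbatim

* [Perry2026Semiregularity] (arXiv:2604.00511, April 2026, UNREFEREED preprint), Thm. 1.1: «Let `f : X → S` be
  a smooth proper family of complex varieties. Let `0 ∈ S(ℂ)` be a point and let `E₀ ∈ D_perf(X₀)` be a semiregular
  perfect complex with `Ext^{<0}(E₀, E₀) = 0`. Assume that `B₀ ∈ H²(X₀, ℚ(1))` is an algebraic class such that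
  `w₀ = exp(B₀) · ch(E₀) ∈ ⊕_{k ≥ 0} H^{2k}(X₀, ℚ(k))` remains Hodge along `S`, i.e. lifts to a global section
  `w` of the local system `⊕_{k ≥ 0} R^{2k} f_* ℚ(k)`. Then: • The object `E₀` deforms as a twisted perfect
  complex over an étale neighborhood of `0`. […] • The class `w₀` remains algebraic along `S`, i.e. for every
  point `s ∈ S(ℂ)` the fiber `w_s ∈ ⊕_{k≥0} H^{2k}(X_s, ℚ(k))` of `w` over `s` is algebraic.» Def. 2.4: «An object
  `E ∈ 𝒞` is semiregular if the map `σ²_E : Ext²_k(E, E) → HH_{-2}(𝒞)` is injective.» Rem. 2.5: for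
  `𝒞 = D_perf(X)` this «can be identified (after applying an HKR isomorphism) with the semiregularity map of
  Buchweitz and Flenner» — i.e. the FULL map `σ = (σ_q)_q : Ext²(E, E) → ⊕_q H^{q+2}(X, Ω^q_X)`.
* [BuchweitzFlenner2003] Def. 4.1 (p. 166): «Let `X → Y` be a morphism of complex spaces and let `F` be a
  perfect complex of `𝒪_X`-modules. The map `σ := Tr(∗ · exp(-At(F))) : Ext²_X(F, F) → ∏_k H^{k+2}(X, Λ^k 𝕃_{X/Y})`
  is called the semiregularity map for `F`.» Thm. 5.1 (p. 174–175) is printed for an `I`-semiregular SHEAF `ℰ₀`.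
* The REFEREED chain replacing Perry's Thm. 1.1 (second bullet, untwisted `B₀ = 0`) for the cell's object, as
  assembled in `theory/TH2-ASSEMBLY-NOTE-2PAGE.md` §2–§3 (file of record; every locator re-read there and by the
  referees): GLOBAL half = [Perry2022] Prop. 8.1 («Let `𝒞 ⊂ D_perf(X)` be an `S`-linear admissible subcategory, where
  `X → S` is a smooth proper morphism of complex varieties. Let `φ` be a section of the local system
  `K_top[0](𝒞/S)`. Assume there exists a complex point `0 ∈ S(ℂ)` such that the fiber `φ₀ ∈ K_top[0](𝒞₀)` is
  the class of an object `E₀ ∈ 𝒞₀` with the property that `𝓜(𝒞/S, φ) → S` is smooth at `E₀`. Then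
  `φ_s ∈ K_top[0](𝒞_s)` is algebraic for every `s ∈ S(ℂ)`.»); LOCAL half («the moduli of perfect complexes
  `𝓜(D_perf(𝒳)/S) → S` is smooth at `[𝓔]`») = (L1) [Lieblich2006] Thm. 4.2.1 / Cor. 4.3.3 + [Perry2022] §7.1,
  Lemma 7.3 (the stack of universally gluable relatively perfect complexes is Artin, l.f.p.); (L2) [Perry2022] §8,
  proof of Prop. 8.1 (small extensions suffice; `S` smooth at `0`); (L3) [Pridham2024Semiregularity] Lemma 1.8 / Cor. 2.22
  (obstruction `o(ℱ) ∈ Ext²(ℱ, ℱ ⊗ I) ≅ Ext²(𝓔, 𝓔) ⊗ I`); (L4) [Pridham2024Semiregularity] Cor. 2.25 + Rem. 2.27 + Rem. 2.21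
  (published numbering; «the image of the obstruction `o_e(𝓔)` under `𝓛_{p-1}` […] is the obstruction to lifting
  `ch_p(𝓔)`» horizontally inside `F^p`; `𝓛 =` the semiregularity map `σ` of [BF03]); (L5) [Deligne1968] Thm. 5.5
  (Hodge filtration of a smooth projective morphism: locally free graded pieces, base change, degeneration) — with
  a REDUCED base, a flat section of type `(p,p)` at every point lies in the sub-bundle `F^p`, hence so does its
  restriction to every Artinian thickening of `s₀`: every `ch_p(𝓔)`, `p ≥ 1`, stays in `F^p`; (L6)
  [BuchweitzFlenner2003] Rem. 4.7 (1) (base change of `σ`) — the FULL `σ_𝓔` kills `o(ℱ)`; `σ_𝓔` injective ⟹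
  `o(ℱ) = 0` ⟹ formally smooth at `[𝓔]`, l.f.p. ⟹ smooth. Uses: `Ext^{<0}(𝓔, 𝓔) = 0` (a point of Lieblich's
  stack), FULL semiregularity, and the Hodge condition in EVERY Chern degree `1 ≤ p ≤ dim` (not only the degree of
  the class of interest; `p = 0` and `p > dim` are automatic). DERIVATION OF THE LOCAL FORM typed below (seat p4;
  for the referee): smooth at `[𝓔]` ⟹ a smooth chart `T → S` of a neighbourhood of `[𝓔]` with a perfect complex
  `ℰ` on `𝒳_T`, `ℰ_{t₀} ≃ 𝓔`; smooth morphisms have analytic local sections, so on a small connected open `W ∋ s₀`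
  inside `U` there is `σ : W → T^an`, `σ(s₀) = t₀`, and `E_t := ℰ_{σ(t)} ∈ D_perf(X_t)`; `t ↦ ch_p(E_t)` is a flat
  section over `W` through `ch_p(𝓔)` (restriction of `ch_p(σ^*ℰ)`), so it IS the transport of `ch_p(𝓔)` along paths
  in `W`, and `ch_p` of a perfect complex on the smooth projective `X_t` is algebraic (`chPerfect_mem_algebraicClasses`).
  Neither [Perry2022] Prop. 8.1 nor irreducibility of `S` is needed for this LOCAL form; they (or the tree's
  `charlesSchnell_algebraicityLocus_iUnion_closed`) enter only when a consumer globalises.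
* [Fulton1998] §15.1 («`ch : K(X) → A(X)_ℚ` determined by the following properties […]»; `K⁰X` and its
  relations `[E] = [E'] + [E'']`) and Example 3.2.3; Prop. 19.1.2 / Cor. 19.2 (b) (algebraicity of `ch` on smooth
  projective varieties) — in the tree: the fields of `ChernCharacterBetti`; [Schlichting2011HigherKTheory]
  §3.1.3 / Exercise 3.1.4 (`K₀(D^b Vect X) → K₀(Vect X)`, `[A, d] ↦ Σ (-1)^i [Aⁱ]` is well defined) — in the tree:
  `KTheory.IsBoundedVBComplex`, `KTheory.eulerChar`, `KTheory.IsBoundedVBComplex.eulerChar_eq_of_quasiIso`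
  (all PROVED). «Perfect complex» is read throughout as a bounded complex of finite locally free modules
  (strictly perfect; on a smooth quasi-projective variety every perfect complex is quasi-isomorphic to one).

## Kernel content (what IS checked here) and the honesty clause (what is NOT)

1. REAL vocabulary: the Chern character `chKZero C X k : K₀(X) →+ H^{2k}(X(ℂ); ℂ)` of a Chern character theory
   `C : ChernCharacterBetti` (universal property of `K₀`, additivity field of `C`), and `chPerfect C X E hE k :=
   chKZero (χ(E))` for a complex `E` of vector bundles, with: the alternating-sum formula, `ch(E₀[0]) = ch(E₀)`,
   INVARIANCE UNDER QUASI-ISOMORPHISM (so `ch` is defined on the perfect complex, not on the model),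
   compatibility with pull-back, rationality, and ALGEBRAICITY on smooth projective `X`
   (`chPerfect_mem_algebraicClasses`) — the latter is the in-tree half of «objects on the nearby fibres ⟹
   classes algebraic there».
2. The OBJECT CLASS `perfectObjClass C Adm` in the door-agnostic currency of the cell's assembly file (seat p7,
   `AmplificationChainAssembly.lean`: `ObjClass := ℕ → (X₀ : SchemeOver ℂ) → Finset ℕ → (∀ p, H^{2p}(X₀(ℂ); ℂ)) →
   Prop`): «`κ|_I` is the Chern character of a bounded complex of vector bundles on `X₀` that is ADMISSIBLE»,
   where `Adm : AdmissibilityNotion` is a PARAMETER.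
3. The TRANSFER `PerfectComplexVariationalHodge C Adm : Prop` — the binders of the refereed tree fact
   `BuchweitzFlenner2003_variationalHodge_ISemiregular_model` VERBATIM (algebraic smooth projective family over a
   smooth base, cohomologically locally trivial `U`, model `e : X₀ ≅ 𝒳_{s₀}`, Hodge type of the flat transports
   along paths for `p ∈ I`, conclusion on an open `W ∋ s₀`) with «finite locally free `I`-semiregular `ℰ₀`,
   `ch_p(ℰ₀)`» replaced by «`perfectObjClass C Adm n X₀ I κ`, `κ p`».
4. HONESTY CLAUSE. The INTENDED admissibility notion — «`{1, …, n} ⊆ I`, `Ext^{<0}_{D(X₀)}(E, E) = 0`, `E` simple,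
   and the FULL Buchweitz–Flenner semiregularity map `σ_E : Ext²(E, E) → ⊕_q H^{q+2}(X₀, Ω^q)` is injective» — is
   NOT a definition of the tree: the semiregularity map (Atiyah class and trace) of a perfect COMPLEX has no
   carrier at the pin (the tree's real `σ`, `sigmaHigher` / `IsISemiregular`, is for finite locally free
   MODULES; cell records `theory/TH1-PERFECT-COMPLEX.md` §4(c), `theory/TH2-PERRY-ASSEMBLY-TYPABILITY.md` §2 (K2)).
   Hence items 2–3 and every consumer are a SCHEMA in `Adm`: for the intended `Adm`,
   `PerfectComplexVariationalHodge C Adm` is, in print, Perry's Thm. 1.1 (second bullet, `B₀ = 0`; preprint) and,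
   for the cell's object, the refereed chain above — an ASSUMPTION BY NAME of the venture, not a kernel fact and
   not a Literature fact; for `Adm := bfAdmissible` (complexes concentrated in degree `0` with an `I`-semiregular
   finite locally free term) it IS the refereed tree fact — `perfectComplexVariationalHodge_bf`, PROVED below,
   the sanity instance showing that the schema specialises to Buchweitz–Flenner's printed sheaf theorem; for
   `Adm := ⊤` it would be Grothendieck's variational Hodge conjecture for all Chern characters (open) — so a
   consumer's theorem is exactly as strong as the admissibility notion it is fed, and the kernel cannot tell the
   notions apart. What the kernel DOES certify for the intended `Adm`: the shape of the chain from the local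
   clause to the cell's conclusion, and that the only object-specific inputs are «admissible» (census (I1)–(I2),
   by value) and «`κ = ch(𝓔)` with the stated Weil component» (census (I3), by value).
5. NOT here: the `μ₂`-twisted variant (`B₀ ≠ 0`; seat th-4 / `Perry2026_semiregularTwisted_remainsAlgebraic`),
   the `𝒜_g`-component and Weil-anchor plumbing (seats p3 / p7 / t-7: `hc_on_siegelComponent_of_germ_of_smul_add_at`,
   `WeilAnchorLocalClause`), any statement about sixfolds.
-/

noncomputable section

open CategoryTheory CategoryTheory.Limits AlgebraicGeometry
open _root_.Topology _root_.Filter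
open Literature.AlgebraicGeometry.Motives Literature.AlgebraicGeometry.HodgeTheory
open Literature.AlgebraicGeometry.KTheory
open Literature.AlgebraicTopology.SingularHomology

namespace Summit.Ventures.HSemireg

/-! ### 1. The Chern character on `K₀(X)` and of a bounded complex of vector bundles (real vocabulary) -/

section ChernCharacter

variable (C : ChernCharacterBetti) (X : SchemeOver ℂ)

/-- **The Chern character on the Grothendieck group of vector bundles**, degree `k`:
`ch_k : K₀(X) →+ H^{2k}(X(ℂ); ℂ)`, `[E] ↦ ch_k(E)` — well defined by the additivity of `ch` on short exact
sequences of vector bundles («`ch : K(X) → A(X)_ℚ` determined by the following properties […]»; the tree's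
`KTheory.KZero.lift`). [cite: Fulton1998, §15.1 and Example 3.2.3] -/
def chKZero (k : ℕ) : KZero X.left →+ complexBetti X (2 * k) :=
  KZero.lift (fun E _ => C.ch X E k) fun S hS h₁ _ h₃ =>
    C.ch_shortExact S hS h₁.isVectorBundle h₃.isVectorBundle k

/-- `ch_k([E]) = ch_k(E)` on the class of a vector bundle. [cite: Fulton1998, §15.1] -/
@[simp]
theorem chKZero_of (k : ℕ) (E : X.left.Modules) (hE : IsFiniteLocallyFree E) :
    chKZero C X k (KZero.of E hE) = C.ch X E k :=
  KZero.lift_of _ _ E hE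

/-- **Naturality**: `f^*(ch_k(x)) = ch_k(f^* x)` for `x ∈ K₀(X)` (from `ch ∘ f^* = f^* ∘ ch` on vector bundles,
the generators of `K₀`). [cite: Fulton1998, §15.1 (ii)] -/
theorem map_chKZero {Y : SchemeOver ℂ} (f : Y ⟶ X) (k : ℕ) (x : KZero X.left) :
    complexBetti.map f (2 * k) (chKZero C X k x) = chKZero C Y k (KZero.map f.left x) := by
  induction x using KZero.induction_on with
  | zero => simp only [map_zero]
  | of E hE => rw [chKZero_of, KZero.map_of, chKZero_of]; exact C.map_ch f E hE.isVectorBundle k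
  | neg x hx => simp only [map_neg, hx]
  | add x y hx hy => simp only [map_add, hx, hy]

/-- Every class `ch_k(x)`, `x ∈ K₀(X)`, is rational (the generators' are). [cite: VoisinHodgeI2002, Thm. 11.23] -/
theorem isRationalClass_chKZero (k : ℕ) (x : KZero X.left) : IsRationalClass (chKZero C X k x) := by
  induction x using KZero.induction_on with
  | zero => rw [map_zero]; exact IsRationalClass.zero
  | of E hE => rw [chKZero_of]; exact C.isRationalClass_ch X E hE.isVectorBundle k
  | neg x hx =>
    rw [map_neg]
    have h := hx.smul (-1 : ℚ)
    rwa [Rat.cast_neg, Rat.cast_one, neg_one_smul] at h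
  | add x y hx hy => rw [map_add]; exact hx.add hy

/-- On a smooth projective `X`, every class `ch_k(x)`, `x ∈ K₀(X)`, is ALGEBRAIC (`ch_k(E) ∈ N^k H^{2k}` for the
generators; algebraic classes form a subgroup). [cite: Fulton1998, Prop. 19.1.2 and Cor. 19.2 (b)] -/
theorem chKZero_mem_algebraicClasses {n : ℕ} (hX : IsSmoothProjective n X) (k : ℕ) (x : KZero X.left) :
    chKZero C X k x ∈ algebraicClasses X k := by
  induction x using KZero.induction_on with
  | zero => rw [map_zero]; exact Submodule.zero_mem _
  | of E hE => rw [chKZero_of]; exact C.ch_mem_algebraicClasses hX E hE.isVectorBundle k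
  | neg x hx => rw [map_neg]; exact Submodule.neg_mem _ hx
  | add x y hx hy => rw [map_add]; exact Submodule.add_mem _ hx hy

/-- **The Chern character of a bounded complex of vector bundles** (a strictly perfect complex), degree `k`:
`ch_k(E•) := ch_k(χ(E•))`, `χ(E•) = Σ_i (-1)^i [E^i] ∈ K₀(X)` the tree's `KTheory.eulerChar` — the Chern character
of the class of the perfect complex in `K₀(X) = K₀(D^b Vect X)`. [cite: Fulton1998, §15.1]
[cite: Schlichting2011HigherKTheory, Exercise 3.1.4] -/
def chPerfect (E : CochainComplex X.left.Modules ℤ) (hE : ∀ i, IsFiniteLocallyFree (E.X i)) (k : ℕ) :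
    complexBetti X (2 * k) :=
  chKZero C X k (eulerChar E hE)

/-- **Alternating-sum formula**: `ch_k(E•) = Σ_{i ∈ s} (-1)^i ch_k(E^i)` for any finite set `s` of degrees off
which the terms vanish. [cite: Fulton1998, §15.1 and Example 3.2.3] -/
theorem chPerfect_eq_sum (E : CochainComplex X.left.Modules ℤ) (hE : ∀ i, IsFiniteLocallyFree (E.X i))
    (s : Finset ℤ) (hs : ∀ i ∉ s, IsZero (E.X i)) (k : ℕ) :
    chPerfect C X E hE k = ∑ i ∈ s, ((i.negOnePow : ℤˣ) : ℤ) • C.ch X (E.X i) k := by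
  rw [chPerfect, eulerChar_eq_sum hE s hs, map_sum]
  refine Finset.sum_congr rfl fun i _ => ?_
  rw [map_zsmul, chKZero_of]

/-- **A complex concentrated in degree `0`**: if every term off degree `0` is a zero object then
`ch_k(E•) = ch_k(E⁰)`. [cite: Fulton1998, Example 3.2.3] -/
theorem chPerfect_eq_ch_zero (E : CochainComplex X.left.Modules ℤ) (hE : ∀ i, IsFiniteLocallyFree (E.X i))
    (h0 : ∀ i : ℤ, i ≠ 0 → IsZero (E.X i)) (k : ℕ) : chPerfect C X E hE k = C.ch X (E.X 0) k := by
  rw [chPerfect_eq_sum C X E hE {0} (fun i hi => h0 i (by simpa using hi)) k, Finset.sum_singleton,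
    Int.negOnePow_zero, Units.val_one, one_smul]

/-- **`ch(E₀[0]) = ch(E₀)`** for a vector bundle `E₀` placed in degree `0`. [cite: Fulton1998, Example 3.2.3] -/
theorem chPerfect_single (E₀ : X.left.Modules) (hE₀ : IsFiniteLocallyFree E₀)
    (h : ∀ i, IsFiniteLocallyFree (((HomologicalComplex.single _ (ComplexShape.up ℤ) 0).obj E₀).X i)) (k : ℕ) :
    chPerfect C X ((HomologicalComplex.single _ (ComplexShape.up ℤ) 0).obj E₀) h k = C.ch X E₀ k := by
  rw [chPerfect, eulerChar_single E₀ hE₀ 0 h, Int.negOnePow_zero, Units.val_one, one_smul, chKZero_of]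

/-- `ch_k(E•)` depends only on the terms (degreewise isomorphic complexes, whatever their differentials, have
the same Chern character). [folklore] -/
theorem chPerfect_eq_of_iso {E F : CochainComplex X.left.Modules ℤ} (hE : ∀ i, IsFiniteLocallyFree (E.X i))
    (hF : ∀ i, IsFiniteLocallyFree (F.X i)) (e : ∀ i, E.X i ≅ F.X i) (k : ℕ) :
    chPerfect C X E hE k = chPerfect C X F hF k := by
  rw [chPerfect, chPerfect, eulerChar_eq_of_iso hE hF e]

/-- **Invariance under quasi-isomorphism**: quasi-isomorphic bounded complexes of vector bundles have the same
Chern character — `ch` is an invariant of the PERFECT COMPLEX (its class in `K₀(D^b Vect X) = K₀(X)`), not of the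
chosen locally free model (the tree's PROVED `eulerChar_eq_of_quasiIso`).
[cite: Schlichting2011HigherKTheory, Exercise 3.1.4] [cite: Fulton1998, §15.1] -/
theorem chPerfect_eq_of_quasiIso {E F : CochainComplex X.left.Modules ℤ} (hE : IsBoundedVBComplex E)
    (hF : IsBoundedVBComplex F) (φ : E ⟶ F) [QuasiIso φ] (k : ℕ) :
    chPerfect C X E hE.isFiniteLocallyFree k = chPerfect C X F hF.isFiniteLocallyFree k := by
  rw [chPerfect, chPerfect, hE.eulerChar_eq_of_quasiIso hF φ]

/-- **Compatibility with pull-back**: `f^*(ch_k(E•)) = ch_k(f^*E•)` for the termwise (= derived, the terms being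
flat) pull-back of a bounded complex of vector bundles. [cite: Fulton1998, §15.1 (ii)] -/
theorem map_chPerfect {Y : SchemeOver ℂ} (f : Y ⟶ X) {E : CochainComplex X.left.Modules ℤ}
    (hE : IsBoundedVBComplex E) (k : ℕ) :
    complexBetti.map f (2 * k) (chPerfect C X E hE.isFiniteLocallyFree k) =
      chPerfect C Y (((Scheme.Modules.pullback f.left).mapHomologicalComplex _).obj E)
        (hE.pullback f.left).isFiniteLocallyFree k := by
  rw [chPerfect, chPerfect, map_chKZero, map_eulerChar f.left hE]

/-- The Chern character of a complex of vector bundles is a rational class. [cite: VoisinHodgeI2002, Thm. 11.23] -/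
theorem isRationalClass_chPerfect (E : CochainComplex X.left.Modules ℤ) (hE : ∀ i, IsFiniteLocallyFree (E.X i))
    (k : ℕ) : IsRationalClass (chPerfect C X E hE k) :=
  isRationalClass_chKZero C X k _

/-- **The Chern character of a complex of vector bundles on a smooth projective variety is an ALGEBRAIC class.**
This is the in-tree half of «perfect complexes with the right Chern character exist on the nearby fibres ⟹ the
classes are algebraic there». [cite: Fulton1998, Prop. 19.1.2 and Cor. 19.2 (b)] -/
theorem chPerfect_mem_algebraicClasses {n : ℕ} (hX : IsSmoothProjective n X) (E : CochainComplex X.left.Modules ℤ)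
    (hE : ∀ i, IsFiniteLocallyFree (E.X i)) (k : ℕ) : chPerfect C X E hE k ∈ algebraicClasses X k :=
  chKZero_mem_algebraicClasses C X hX k _

end ChernCharacter

/-! ### 2. The object class «Chern character of an admissible perfect complex» -/

section Door

/-- **An admissibility notion for perfect complexes** — the PARAMETER of this file: a predicate `Adm n X₀ I E`
on a relative dimension `n`, a `ℂ`-scheme `X₀`, a finite set `I` of Chern degrees and a cochain complex `E` of
`𝒪_{X₀}`-modules. INTENDED instance (no carrier in the tree, see the module docstring, item 4): «`{1, …, n} ⊆ I`,
`Ext^{<0}_{D(X₀)}(E, E) = 0`, `Ext⁰ = ℂ`, and the FULL Buchweitz–Flenner semiregularity map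
`σ_E = Tr(∗ · exp(-At E)) : Ext²(E, E) → ⊕_q H^{q+2}(X₀, Ω^q)` is injective» (BF Def. 4.1 for a perfect complex;
Perry Def. 2.4 / Rem. 2.5). A TYPED instance: `bfAdmissible` below.
[cite: BuchweitzFlenner2003, Def. 4.1] [cite: Perry2026Semiregularity, Def. 2.4 and Rem. 2.5] -/
abbrev AdmissibilityNotion : Type 1 :=
  ∀ (_ : ℕ) (X₀ : SchemeOver ℂ), Finset ℕ → CochainComplex X₀.left.Modules ℤ → Prop

/-- **The object class of the perfect-complex door**, in the door-agnostic currency of the cell's assembly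
(`ObjClass := ℕ → (X₀ : SchemeOver ℂ) → Finset ℕ → (∀ p, H^{2p}(X₀(ℂ); ℂ)) → Prop`, seat p7):
`perfectObjClass C Adm n X₀ I κ` ⟺ there is a bounded complex of vector bundles `E` on `X₀`, ADMISSIBLE
(`Adm n X₀ I E`), whose Chern character in the degrees `p ∈ I` is `κ_p`. For the intended `Adm` this reads
«`κ|_I = ch(E)|_I` for a semiregular perfect complex `E` with `Ext^{<0}(E, E) = 0`» — the hypothesis on `E₀` in
Perry's Thm. 1.1 with `B₀ = 0`. [cite: Perry2026Semiregularity, Thm. 1.1 (hypotheses) and Def. 2.4]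
[cite: BuchweitzFlenner2003, Def. 4.1] -/
def perfectObjClass (C : ChernCharacterBetti) (Adm : AdmissibilityNotion) (n : ℕ) (X₀ : SchemeOver ℂ)
    (I : Finset ℕ) (κ : ∀ p : ℕ, complexBetti X₀ (2 * p)) : Prop :=
  ∃ (E : CochainComplex X₀.left.Modules ℤ) (hE : IsBoundedVBComplex E),
    Adm n X₀ I E ∧ ∀ p ∈ I, κ p = chPerfect C X₀ E hE.isFiniteLocallyFree p

/-- The classes of an object of the class are algebraic ON `X₀` ITSELF when `X₀` is smooth projective (no transfer
involved: `ch` of a complex of vector bundles). [cite: Fulton1998, Prop. 19.1.2 and Cor. 19.2 (b)] -/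
theorem perfectObjClass.mem_algebraicClasses {C : ChernCharacterBetti} {Adm : AdmissibilityNotion} {n m : ℕ}
    {X₀ : SchemeOver ℂ} (hX₀ : IsSmoothProjective m X₀) {I : Finset ℕ} {κ : ∀ p : ℕ, complexBetti X₀ (2 * p)}
    (h : perfectObjClass C Adm n X₀ I κ) {p : ℕ} (hp : p ∈ I) : κ p ∈ algebraicClasses X₀ p := by
  obtain ⟨E, hE, -, hκ⟩ := h
  rw [hκ p hp]
  exact chPerfect_mem_algebraicClasses C X₀ hX₀ E hE.isFiniteLocallyFree p

/-- The classes of an object of the class are rational. [cite: VoisinHodgeI2002, Thm. 11.23] -/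
theorem perfectObjClass.isRationalClass {C : ChernCharacterBetti} {Adm : AdmissibilityNotion} {n : ℕ}
    {X₀ : SchemeOver ℂ} {I : Finset ℕ} {κ : ∀ p : ℕ, complexBetti X₀ (2 * p)}
    (h : perfectObjClass C Adm n X₀ I κ) {p : ℕ} (hp : p ∈ I) : IsRationalClass (κ p) := by
  obtain ⟨E, hE, -, hκ⟩ := h
  rw [hκ p hp]
  exact isRationalClass_chPerfect C X₀ E hE.isFiniteLocallyFree p

/-- Monotonicity in the admissibility notion: a STRONGER notion `Adm'` (fewer admissible objects) gives a smaller
object class. [folklore] -/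
theorem perfectObjClass.mono {C : ChernCharacterBetti} {Adm Adm' : AdmissibilityNotion}
    (hle : ∀ n X₀ I E, Adm' n X₀ I E → Adm n X₀ I E) {n : ℕ} {X₀ : SchemeOver ℂ} {I : Finset ℕ}
    {κ : ∀ p : ℕ, complexBetti X₀ (2 * p)} (h : perfectObjClass C Adm' n X₀ I κ) :
    perfectObjClass C Adm n X₀ I κ := by
  obtain ⟨E, hE, hA, hκ⟩ := h
  exact ⟨E, hE, hle n X₀ I E hA, hκ⟩

/-! ### 3. The transfer statement (schema in `Adm`) -/

/-- **The perfect-complex door of the amplification chain: «the Chern character of an ADMISSIBLE perfect complex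
at one fibre, if it stays Hodge, stays algebraic on the nearby fibres»** — the binders of the refereed tree fact
`BuchweitzFlenner2003_variationalHodge_ISemiregular_model` VERBATIM with the finite locally free `I`-semiregular
sheaf replaced by the object class `perfectObjClass C Adm`: for every smooth projective family `π : 𝒳 ⟶ S` of
relative dimension `n` over a smooth `ℂ`-scheme `S`, cohomologically locally trivial `U ⊆ S(ℂ)` with base point
`s₀`, model `e : X₀ ≅ 𝒳_{s₀}`, classes `κ = (κ_p)_p` on `X₀` and finite `I` with `perfectObjClass C Adm n X₀ I κ`:
if for every `p ∈ I` the flat transports of `(e⁻¹)^* κ_p` along all paths in `U` are of type `(p, p)`, then on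
some open `W`, `s₀ ∈ W ⊆ U`, those transports along paths inside `W` are ALGEBRAIC. STATUS (module docstring,
item 4): a SCHEMA in `Adm`. For the INTENDED `Adm` (full semiregularity, `Ext^{<0} = 0`, simple, `{1..n} ⊆ I`)
this is the LOCAL shape (Hodge hypothesis and conclusion near `s₀`, along paths in `U`; algebraic smooth
PROJECTIVE family over a smooth base) of the statement printed GLOBALLY as the second bullet of Perry's Thm. 1.1
with `B₀ = 0` (preprint, claim-grade; «`S` a complex variety», smooth proper `f`, `w` a global section, conclusion
for every `s ∈ S(ℂ)`), and it follows — refereed, derivation of record in the module docstring — from the LOCAL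
half (L1)–(L6) of `theory/TH2-ASSEMBLY-NOTE-2PAGE.md` §3 (smoothness of the moduli of perfect complexes at `[E]`);
it is an ASSUMPTION BY NAME of the venture and no declaration of the tree discharges it. For `Adm := bfAdmissible` it is PROVED from the refereed fact
(`perfectComplexVariationalHodge_bf`). [claim: Perry2026Semiregularity, status: under-review]
[cite: Perry2022, Prop. 8.1] [cite: Pridham2024Semiregularity, Cor. 2.25, Rem. 2.27, Rem. 2.21, Lemma 1.8]
[cite: Lieblich2006, Thm. 4.2.1] [cite: BuchweitzFlenner2003, Def. 4.1, Rem. 4.7 (1), Thm. 5.1]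
[cite: Deligne1968, Thm. 5.5] -/
def PerfectComplexVariationalHodge (C : ChernCharacterBetti) (Adm : AdmissibilityNotion) : Prop :=
  ∀ ⦃𝒳 S : SchemeOver ℂ⦄ (π : 𝒳 ⟶ S) (n : ℕ),
    IsSmoothProjectiveFamily π n → _root_.AlgebraicGeometry.Smooth S.hom →
    ∀ ⦃U : Set (ComplexPoints S)⦄ (hU : IsCohomologicallyLocallyTrivialOn π U) (s₀ : U)
      (X₀ : SchemeOver ℂ) (e : X₀ ≅ fiberOver π s₀.1)
      (κ : ∀ p : ℕ, complexBetti X₀ (2 * p)) (I : Finset ℕ),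
      perfectObjClass C Adm n X₀ I κ →
      (∀ p ∈ I, ∀ (t : U) (γ : Path.Homotopic.Quotient s₀ t),
          IsOfHodgeType n (fiberOver π t.1) (2 * p) p p
            (transportFun π (2 * p) hU γ (complexBetti.map e.inv (2 * p) (κ p)))) →
      ∃ (W : Set (ComplexPoints S)) (hWo : IsOpen W) (hW₀ : s₀.1 ∈ W) (hWU : W ⊆ U),
        ∀ p ∈ I, ∀ (t : W) (γ : Path.Homotopic.Quotient (⟨s₀.1, hW₀⟩ : W) t),
          transportFun π (2 * p) (hU.mono hWU hWo) γ (complexBetti.map e.inv (2 * p) (κ p)) ∈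
            algebraicClasses (fiberOver π t.1) p

/-- **Monotonicity of the transfer in the admissibility notion**: the transfer for a WEAKER notion `Adm` (more
admissible objects) implies the transfer for every stronger notion `Adm'`. (So any future TYPED notion implying
the intended one inherits the assumption; and `Adm := ⊤` is the strongest statement of this shape — Grothendieck's
variational Hodge conjecture for Chern characters of complexes of vector bundles, open.) [folklore] -/
theorem PerfectComplexVariationalHodge.anti {C : ChernCharacterBetti} {Adm Adm' : AdmissibilityNotion}
    (hle : ∀ n X₀ I E, Adm' n X₀ I E → Adm n X₀ I E) (h : PerfectComplexVariationalHodge C Adm) :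
    PerfectComplexVariationalHodge C Adm' :=
  fun _ _ π n hπ hS _ hU s₀ X₀ e κ I hobj hH => h π n hπ hS hU s₀ X₀ e κ I (hobj.mono hle) hH

/-! ### 4. The sanity instance: complexes concentrated in degree `0` with an `I`-semiregular term
(Buchweitz–Flenner 2003, Thm. 5.1 — refereed tree fact) -/

/-- **The Buchweitz–Flenner admissibility notion** (TYPED, on the tree's real carriers): `E` is concentrated in
degree `0` (every other term a zero object) and its degree-`0` term is a finite locally free module whose partial
semiregularity map `(σ_{p-1})_{p ∈ I}` is jointly injective (`IsISemiregular`, real Atiyah class and trace: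
`SemiregularityHigherSigma.lean`) — BF's «`I`-semiregular sheaf `ℰ₀`», placed in degree `0`.
[cite: BuchweitzFlenner2003, §5 (I-semiregular) and Thm. 5.1] -/
def bfAdmissible : AdmissibilityNotion := fun _ (_ : SchemeOver ℂ) (I : Finset ℕ) E =>
  ∃ hE₀ : IsFiniteLocallyFree (E.X 0), (∀ i : ℤ, i ≠ 0 → IsZero (E.X i)) ∧ IsISemiregular hE₀ {q | q + 1 ∈ I}

/-- An `I`-semiregular finite locally free sheaf `E₀`, placed in degree `0`, is a BF-admissible bounded complex of
vector bundles with `ch(E₀[0]) = ch(E₀)`: the object class `perfectObjClass C bfAdmissible` contains BF's seeds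
(`I`-semiregularity is transported along `E₀[0]⁰ ≅ E₀` by the venture's `isISemiregular_of_iso`).
[cite: BuchweitzFlenner2003, §5 (I-semiregular)] -/
theorem perfectObjClass_bf_of_isISemiregular (C : ChernCharacterBetti) (n : ℕ) (X₀ : SchemeOver ℂ) (I : Finset ℕ)
    (E₀ : X₀.left.Modules) (hE₀ : IsFiniteLocallyFree E₀) (hsr : IsISemiregular hE₀ {q | q + 1 ∈ I}) :
    perfectObjClass C bfAdmissible n X₀ I (fun p => C.ch X₀ E₀ p) := by
  have hE : IsBoundedVBComplex ((HomologicalComplex.single _ (ComplexShape.up ℤ) 0).obj E₀) :=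
    IsBoundedVBComplex.single E₀ hE₀ 0
  refine ⟨(HomologicalComplex.single _ (ComplexShape.up ℤ) 0).obj E₀, hE, ?_,
    fun p _ => (chPerfect_single C X₀ E₀ hE₀ hE.isFiniteLocallyFree p).symm⟩
  refine ⟨hE.isFiniteLocallyFree 0,
    fun i hi => HomologicalComplex.isZero_single_obj_X (ComplexShape.up ℤ) 0 E₀ i hi, ?_⟩
  exact isISemiregular_of_iso (HomologicalComplex.singleObjXSelf (ComplexShape.up ℤ) 0 E₀).symm hE₀
    (hE.isFiniteLocallyFree 0) hsr

/-- **Sanity instance: for `Adm := bfAdmissible` the schema IS Buchweitz–Flenner's refereed Thm. 5.1** (model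
form, tree fact `BuchweitzFlenner2003_variationalHodge_ISemiregular_model`): an admissible object has all terms off
degree `0` zero, so `κ_p = ch_p(E•) = ch_p(E⁰)` (`chPerfect_eq_ch_zero`), and the fact applies to `E⁰`.
[cite: BuchweitzFlenner2003, §5 Thm. 5.1] -/
theorem perfectComplexVariationalHodge_bf (hBF : BuchweitzFlenner2003_variationalHodge_ISemiregular_model)
    (C : ChernCharacterBetti) : PerfectComplexVariationalHodge C bfAdmissible := by
  intro 𝒳 S π n hπ hS U hU s₀ X₀ e κ I hobj hH
  obtain ⟨E, hE, ⟨hE₀, hz, hsr⟩, hκ⟩ := hobj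
  have hch : ∀ p ∈ I, κ p = C.ch X₀ (E.X 0) p := fun p hp => by
    rw [hκ p hp, chPerfect_eq_ch_zero C X₀ E hE.isFiniteLocallyFree hz p]
  have hH' : ∀ p ∈ I, ∀ (t : U) (γ : Path.Homotopic.Quotient s₀ t),
      IsOfHodgeType n (fiberOver π t.1) (2 * p) p p
        (transportFun π (2 * p) hU γ (complexBetti.map e.inv (2 * p) (C.ch X₀ (E.X 0) p))) :=
    fun p hp t γ => hch p hp ▸ hH p hp t γ
  obtain ⟨W, hWo, hW₀, hWU, hW⟩ := hBF C π n hπ hS hU s₀ X₀ e (E.X 0) hE₀ I hsr hH'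
  exact ⟨W, hWo, hW₀, hWU, fun p hp t γ => hch p hp ▸ hW p hp t γ⟩

end Door

end Summit.Ventures.HSemireg

end
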